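import Literature.NumberTheory.EllipticCurves.ShaPTorsionQuadraticSplitting
import Literature.NumberTheory.EllipticCurves.BSDRankZeroDensityProofs
import Literature.NumberTheory.EllipticCurves.SelmerTorsionTwistRestriction
import HarnessLib

/-!
# Odd torsion and the `p`-Selmer group over a quadratic field split as curve × twist (`p` odd):
# `#E(K)[n] = #E(F)[n] · #E^{(c)}(F)[n]` (`n` odd) and `#Sel^{(p)}(E_K) = #Sel^{(p)}(E) · #Sel^{(p)}(E^{(c)})`

Topic `NumberTheory/EllipticCurves`; theorems only (no definition, no named fact, no `sorry`, no instance). Sequel of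
`ShaPTorsionQuadraticSplitting` (`#Ш(E_K)[p] = #Ш(E)[p] · #Ш(E^{(c)})[p]`, `rank E(K) = rank E + rank E^{(c)}`) that reaches
the object descent software computes, the `p`-Selmer group `Sel^{(p)}`:

* §1 `WeierstrassCurve.natCard_torsionBy_point_baseChange_quadratic_of_odd` — for a field `F` with `2 ≠ 0`, a quadratic
  extension `K = F(θ)`, `θ² = c`, a Weierstrass curve `W/F` and ODD `n`: `#W(K)[n] = #W(F)[n] · #W^{(c)}(F)[n]`. Mechanism
  (Silverman X.5, Exercise 10.16): on the completed-square model `E' = W^{(1)}` the conjugation `σ` of `K/F` acts on `E'(K)`;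
  `σ`-fixed points come from `E'(F)` (tree `QuadraticDescent.exists_incl_eq`), `σ`-anti-fixed points from the twist via
  `τ : E^{(c)}(F) → E'(K)` (`exists_twistMap_eq`, `conjMap_twistMap`); for ODD `n` the map `(Q, R) ↦ ι Q + τ R` is a
  bijection `E'(F)[n] × E^{(c)}(F)[n] → E'(K)[n]` (`2` is invertible on `n`-torsion).
* §2 `WeierstrassCurve.natCard_selmerGroup_baseChange_quadratic_of_odd` — for an elliptic curve `E/ℚ`, `K = ℚ(θ)`,
  `θ² = c`, and every ODD prime `p`: **`#Sel^{(p)}(E_K/K) = #Sel^{(p)}(E/ℚ) · #Sel^{(p)}(E^{(c)}/ℚ)`**, unconditionally and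
  finiteness-free — the exact descent count `#Sel^{(p)} = p^{rank} · #E[p] · #Ш[p]` (Silverman X.4.2, tree
  `natCard_selmerGroup_eq`) for the three curves, with the three splittings (rank, `E[p]` by §1, `Ш[p]` by
  `natCard_sha_torsionBy_baseChange_quadratic_of_odd`); discriminant form for the tree's models.

At `p = 2` (and for even `n`) the splitting fails; nothing is claimed there.

## References

* J. H. Silverman, *The Arithmetic of Elliptic Curves*, 2nd ed. (2009), Thm. X.4.2, X.5 Cor. 5.4, Exercise 10.16.
  [SilvermanAEC2009]
* T. Dokchitser, V. Dokchitser, On the Birch–Swinnerton-Dyer quotients modulo squares, Ann. of Math. 172 (2010),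
  Lemma 4.14 (proof). [DokchitserDokchitserAnnals2010]
-/

noncomputable section

open scoped Classical AddSubgroup

universe u v

namespace WeierstrassCurve

open Literature.NumberTheory.EllipticCurves Literature.NumberTheory.QuadraticFields
open _root_.WeierstrassCurve.QuadraticDescent

/-! ## §1 Odd torsion over a quadratic extension -/

section OddTorsion

variable {F : Type u} {K : Type v} [Field F] [Field K] [Algebra F K] [NeZero (2 : F)]
  (W : WeierstrassCurve F) (h2 : Module.finrank F K = 2) {θ : K} {c : F}
  (hθ : θ ∉ Set.range (algebraMap F K)) (hc : θ ^ 2 = algebraMap F K c)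

/-- An element killed by `2` and by an odd `n` is `0`. [folklore] -/
private theorem eq_zero_of_two_nsmul_of_odd_nsmul {M : Type*} [AddCommGroup M] {n : ℕ} (hn : Odd n) {x : M}
    (h2x : 2 • x = 0) (hnx : n • x = 0) : x = 0 := by
  obtain ⟨k, rfl⟩ := hn
  rw [two_mul, add_nsmul, add_nsmul, one_nsmul, ← nsmul_add, ← two_nsmul, h2x, nsmul_zero, zero_add] at hnx
  exact hnx

include h2 hθ hc in
/-- **`#E'(K)[n] = #E'(F)[n] · #E^{(c)}(F)[n]` for the completed-square model `E' = W^{(1)}` and ODD `n`**: the map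
`(Q, R) ↦ ι Q + τ R` is a bijection `E'(F)[n] × E^{(c)}(F)[n] → E'(K)[n]` (injective: `ι Q + τ R = 0` and its
`σ`-conjugate `ι Q - τ R = 0` force `2 τ R = 0`, hence `R = 0` as `n` is odd; surjective: for `P ∈ E'(K)[n]`,
`P + σP = ι Q'`, `P - σP = τ R'` and `P = (k+1) · 2P` for `n = 2k+1`). [cite: SilvermanAEC2009, Exercise 10.16] -/
theorem natCard_torsionBy_point_baseChange_quadraticTwist_one_of_odd {n : ℕ} (hn : Odd n) :
    Nat.card (((W.quadraticTwist 1).baseChange K).toAffine.Point[(n : ℤ)]) =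
      Nat.card ((W.quadraticTwist 1).toAffine.Point[(n : ℤ)]) * Nat.card ((W.quadraticTwist c).toAffine.Point[(n : ℤ)]) := by
  set σ := Quadratic.conj h2 hθ hc with hσdef
  have hσθ : σ θ = -θ := Quadratic.conj_gen h2 hθ hc
  have hσσ : ∀ z, σ (σ z) = z := Quadratic.conj_conj h2 hθ hc
  set V := W.quadraticTwist 1 with hV
  set ι : V.toAffine.Point →+ (V.baseChange K).toAffine.Point := incl K V with hι
  set τ : (W.quadraticTwist c).toAffine.Point →+ (V.baseChange K).toAffine.Point := twistMap W hθ hc with hτ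
  have hιinj : Function.Injective ι := incl_injective V
  have hτinj : Function.Injective τ := twistMap_injective W hθ hc
  -- fixed points of `σ` come from `F`, anti-fixed points from the twist
  have hfix : ∀ P : (V.baseChange K).toAffine.Point, conjMap V σ P = P → ∃ Q, ι Q = P := by
    rintro (_ | ⟨x, y, h⟩) hP
    · exact ⟨0, (map_zero ι).trans Affine.Point.zero_def⟩
    · rw [Affine.Point.map_some, Affine.Point.some.injEq] at hP
      obtain ⟨a, ha⟩ := Quadratic.exists_eq_algebraMap_of_conj_eq h2 hθ hc hP.1
      obtain ⟨b, hb⟩ := Quadratic.exists_eq_algebraMap_of_conj_eq h2 hθ hc hP.2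
      exact exists_incl_eq V h ha.symm hb.symm
  have hanti : ∀ P : (V.baseChange K).toAffine.Point, conjMap V σ P = -P → ∃ R, τ R = P := by
    rintro (_ | ⟨x, y, h⟩) hP
    · exact ⟨0, (map_zero τ).trans Affine.Point.zero_def⟩
    · rw [Affine.Point.map_some, Affine.Point.neg_some, Affine.Point.some.injEq,
        negY_quadraticTwist_one_baseChange] at hP
      obtain ⟨a, ha⟩ := Quadratic.exists_eq_algebraMap_of_conj_eq h2 hθ hc hP.1
      obtain ⟨b, hb⟩ := Quadratic.exists_eq_mul_of_conj_eq_neg h2 hθ hc hP.2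
      exact exists_twistMap_eq W hθ hc h ha.symm hb.symm
  have hσι : ∀ Q, conjMap V σ (ι Q) = ι Q := fun Q ↦ conjMap_incl V σ Q
  have hστ : ∀ R, conjMap V σ (τ R) = -τ R := fun R ↦ conjMap_twistMap W hθ hc hσθ R
  -- the comparison map on `n`-torsion
  let f : V.toAffine.Point[(n : ℤ)] × (W.quadraticTwist c).toAffine.Point[(n : ℤ)] →
      (V.baseChange K).toAffine.Point[(n : ℤ)] := fun x ↦
    ⟨ι (x.1 : V.toAffine.Point) + τ (x.2 : (W.quadraticTwist c).toAffine.Point),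
      AddSubgroup.torsionBy.nsmul_iff.mpr (by
        rw [nsmul_add, ← map_nsmul, ← map_nsmul, AddSubgroup.torsionBy.nsmul_iff.mp x.1.2,
          AddSubgroup.torsionBy.nsmul_iff.mp x.2.2, map_zero, map_zero, add_zero])⟩
  have hf : ∀ x, ((f x : (V.baseChange K).toAffine.Point[(n : ℤ)]) : (V.baseChange K).toAffine.Point) =
      ι (x.1 : V.toAffine.Point) + τ (x.2 : (W.quadraticTwist c).toAffine.Point) := fun _ ↦ rfl
  have hbij : Function.Bijective f := by
    constructor
    · rintro ⟨Q, R⟩ ⟨Q', R'⟩ hQR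
      have h0 : ι ((Q : V.toAffine.Point) - Q') + τ ((R : (W.quadraticTwist c).toAffine.Point) - R') = 0 := by
        have := congrArg (fun z : (V.baseChange K).toAffine.Point[(n : ℤ)] ↦ (z : (V.baseChange K).toAffine.Point)) hQR
        simp only [hf] at this
        rw [map_sub, map_sub, sub_add_sub_comm, this, sub_self]
      -- apply `σ`: `ι(Q-Q') - τ(R-R') = 0`, so `2 τ (R-R') = 0`
      have h1 : ι ((Q : V.toAffine.Point) - Q') - τ ((R : (W.quadraticTwist c).toAffine.Point) - R') = 0 := by
        have := congrArg (conjMap V σ) h0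
        rwa [map_add, hσι, hστ, map_zero, ← sub_eq_add_neg] at this
      have h2τ : 2 • τ ((R : (W.quadraticTwist c).toAffine.Point) - R') = 0 := by
        have := sub_eq_zero.mpr (h0.trans h1.symm)
        rw [add_sub_sub_cancel, ← two_nsmul] at this
        exact this
      have hnR : n • ((R : (W.quadraticTwist c).toAffine.Point) - R') = 0 := by
        rw [nsmul_sub, AddSubgroup.torsionBy.nsmul_iff.mp R.2, AddSubgroup.torsionBy.nsmul_iff.mp R'.2, sub_zero]
      have hR : (R : (W.quadraticTwist c).toAffine.Point) - R' = 0 :=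
        eq_zero_of_two_nsmul_of_odd_nsmul hn (by rw [← map_nsmul] at h2τ; exact hτinj (h2τ.trans (map_zero τ).symm)) hnR
      have hQ : (Q : V.toAffine.Point) - Q' = 0 := by
        rw [hR, map_zero, add_zero] at h0
        exact hιinj (h0.trans (map_zero ι).symm)
      exact Prod.ext (Subtype.ext (sub_eq_zero.mp hQ)) (Subtype.ext (sub_eq_zero.mp hR))
    · rintro ⟨P, hP⟩
      have hPn : n • P = 0 := AddSubgroup.torsionBy.nsmul_iff.mp hP
      obtain ⟨Q', hQ'⟩ := hfix (P + conjMap V σ P) (by rw [map_add, conjMap_conjMap V hσσ, add_comm])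
      obtain ⟨R', hR'⟩ := hanti (P - conjMap V σ P) (by rw [map_sub, conjMap_conjMap V hσσ, neg_sub])
      obtain ⟨k, rfl⟩ := hn
      -- `P = (k+1) • 2P = (k+1) • (ι Q' + τ R')`
      have hP2 : P = (k + 1) • (ι Q' + τ R') := by
        rw [hQ', hR', add_add_sub_cancel, ← two_nsmul, smul_smul,
          show (k + 1) * 2 = (2 * k + 1) + 1 by ring, add_nsmul, hPn, one_nsmul, zero_add]
      have hQ'n : (2 * k + 1) • Q' = 0 := by
        apply hιinj
        rw [map_nsmul, hQ', map_zero, nsmul_add, hPn, ← map_nsmul, hPn, map_zero, add_zero]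
      have hR'n : (2 * k + 1) • R' = 0 := by
        apply hτinj
        rw [map_nsmul, hR', map_zero, nsmul_sub, hPn, ← map_nsmul, hPn, map_zero, sub_zero]
      refine ⟨(⟨(k + 1) • Q', AddSubgroup.nsmul_mem _ (AddSubgroup.torsionBy.nsmul_iff.mpr hQ'n) _⟩,
        ⟨(k + 1) • R', AddSubgroup.nsmul_mem _ (AddSubgroup.torsionBy.nsmul_iff.mpr hR'n) _⟩), Subtype.ext ?_⟩
      rw [hf]
      change ι ((k + 1) • Q') + τ ((k + 1) • R') = P
      rw [map_nsmul, map_nsmul, ← nsmul_add, ← hP2]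
  rw [Nat.card_congr (Equiv.ofBijective f hbij).symm, Nat.card_prod]

include h2 hθ hc in
/-- **`#W(K)[n] = #W(F)[n] · #W^{(c)}(F)[n]` for every Weierstrass curve `W/F` (`2 ≠ 0`), `K = F(θ)`, `θ² = c`, and ODD
`n`**: the completed-square case transported along `W ≅ W^{(1)}` over `F` and over `K`. For even `n` this fails (the
`2`-torsion of `W`, `W^{(c)}` and `W_K` coincide). [cite: SilvermanAEC2009, Exercise 10.16] -/
theorem natCard_torsionBy_point_baseChange_quadratic_of_odd {n : ℕ} (hn : Odd n) :
    Nat.card ((W.baseChange K).toAffine.Point[(n : ℤ)]) =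
      Nat.card (W.toAffine.Point[(n : ℤ)]) * Nat.card ((W.quadraticTwist c).toAffine.Point[(n : ℤ)]) := by
  obtain ⟨C, hC⟩ := W.exists_variableChange_quadraticTwist_one
  have hCK : C.map (algebraMap F K) • W.baseChange K = (W.quadraticTwist 1).baseChange K := by
    rw [baseChange, baseChange, map_variableChange, hC]
  have e1 : W.toAffine.Point ≃+ (W.quadraticTwist 1).toAffine.Point :=
    (VariableChange.pointEquiv W C).trans (Affine.Point.congrEquiv hC)
  have e2 : (W.baseChange K).toAffine.Point ≃+ ((W.quadraticTwist 1).baseChange K).toAffine.Point :=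
    (VariableChange.pointEquiv (W.baseChange K) (C.map (algebraMap F K))).trans (Affine.Point.congrEquiv hCK)
  rw [Nat.card_congr (torsionByEquiv e1 n).toEquiv, Nat.card_congr (torsionByEquiv e2 n).toEquiv]
  exact natCard_torsionBy_point_baseChange_quadraticTwist_one_of_odd W h2 hθ hc hn

end OddTorsion

/-! ## §2 The `p`-Selmer group over a quadratic field, `p` odd -/

section Selmer

variable (W : WeierstrassCurve ℚ) [W.IsElliptic] (K : Type) [Field K] [NumberField K]
  (h2 : Module.finrank ℚ K = 2) {θ : K} {c : ℚ} (hθ : θ ∉ Set.range (algebraMap ℚ K))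
  (hc : θ ^ 2 = algebraMap ℚ K c)

/-- The exact descent count with `Ш[p]` as the `p`-torsion of `Ш`: `#Sel^{(p)}(E/L) = p^{rank E(L)} · #E(L)[p] · #Ш(E/L)[p]`
(tree `natCard_selmerGroup_eq`, Silverman X.4.2, with `#(Ш ⊓ H¹(L,E)[p]) = #Ш[p]`). [cite: SilvermanAEC2009, Thm X.4.2] -/
theorem natCard_selmerGroup_eq_pow_mul_mul {L : Type} [Field L] [NumberField L] (X : WeierstrassCurve L) [X.IsElliptic]
    (p : ℕ) (hp : p ≠ 0) :
    Nat.card (X.selmerGroup p) = p ^ X.mordellWeilRank * Nat.card (X.toAffine.Point[(p : ℤ)]) *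
      Nat.card (X.sha[(p : ℤ)]) := by
  rw [X.natCard_selmerGroup_eq hp, Literature.Algebra.Module.natCard_torsionBy_addSubgroup]

include h2 hθ hc in
/-- **`#Sel^{(p)}(E_K/K) = #Sel^{(p)}(E/ℚ) · #Sel^{(p)}(E^{(c)}/ℚ)` for every ODD prime `p`** (`K = ℚ(θ)`, `θ² = c`),
unconditionally and with no finiteness hypothesis on `Ш`: multiply the three splittings — `rank E(K) = rank E + rank E^{(c)}`
(`mordellWeilRank_baseChange_eq_add`), `#E(K)[p] = #E(ℚ)[p] · #E^{(c)}(ℚ)[p]` (§1) and `#Ш(E_K)[p] = #Ш(E)[p] · #Ш(E^{(c)})[p]`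
(`natCard_sha_torsionBy_baseChange_quadratic_of_odd`) — inside the exact descent count `#Sel^{(p)} = p^{rank} · #E[p] · #Ш[p]`
(Silverman X.4.2). Deliberate dot-notation extension of Mathlib's `WeierstrassCurve` namespace.
[cite: SilvermanAEC2009, Thm X.4.2 and Exercise 10.16] [cite: DokchitserDokchitserAnnals2010, Lemma 4.14 (proof)] -/
theorem natCard_selmerGroup_baseChange_quadratic_of_odd (p : ℕ) [hp : Fact p.Prime] (hp2 : p ≠ 2) :
    Nat.card ((W.baseChange K).selmerGroup p) =
      Nat.card (W.selmerGroup p) * Nat.card ((W.quadraticTwist c).selmerGroup p) := by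
  haveI : (W.baseChange K).IsElliptic := by rw [baseChange]; infer_instance
  have hc0 : c ≠ 0 := by
    rintro rfl
    apply Quadratic.ne_zero_of_not_mem_range hθ
    have : θ ^ 2 = 0 := by rw [hc, map_zero]
    exact pow_eq_zero_iff (n := 2) (by norm_num) |>.mp this
  haveI : (W.quadraticTwist c).IsElliptic := W.isElliptic_quadraticTwist hc0
  have hodd : Odd p := hp.out.odd_of_ne_two hp2
  rw [natCard_selmerGroup_eq_pow_mul_mul (W.baseChange K) p hp.out.ne_zero,
    natCard_selmerGroup_eq_pow_mul_mul W p hp.out.ne_zero,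
    natCard_selmerGroup_eq_pow_mul_mul (W.quadraticTwist c) p hp.out.ne_zero,
    mordellWeilRank_baseChange_eq_add W K h2 hθ hc, natCard_torsionBy_point_baseChange_quadratic_of_odd W h2 hθ hc hodd,
    natCard_sha_torsionBy_baseChange_quadratic_of_odd W K h2 hθ hc p hp2, pow_add]
  ring

/-- The discriminant form for the tree's models: `#Sel^{(p)}(E_K) = #Sel^{(p)}(E) · #Sel^{(p)}(E^{(d_K)})` for odd `p`
(`E^{(d_K)} ≅ E^{(c)}` over `ℚ` as `d_K = c q²`; `#Sel^{(p)}` is a model invariant through the descent count).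
[cite: SilvermanAEC2009, Thm X.4.2 and Exercise 10.16] [cite: DokchitserDokchitserAnnals2010, Lemma 4.14 (proof)] -/
theorem natCard_selmerGroup_baseChange_quadratic_discr_of_odd (W : WeierstrassCurve ℚ) [W.IsElliptic] (K : Type)
    [Field K] [NumberField K] (h2 : Module.finrank ℚ K = 2) (p : ℕ) [hp : Fact p.Prime] (hp2 : p ≠ 2) :
    Nat.card ((W.baseChange K).selmerGroup p) =
      Nat.card (W.selmerGroup p) * Nat.card ((W.quadraticTwist (NumberField.discr K : ℚ)).selmerGroup p) := by
  obtain ⟨θ, c, hθ, hc⟩ := Quadratic.exists_sq_eq_algebraMap (F := ℚ) (K := K) h2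
  obtain ⟨q, hq, hd⟩ := NumberField.exists_discr_eq_mul_sq h2 hθ hc
  obtain ⟨C₁, hC₁⟩ := W.exists_variableChange_quadraticTwist_mul_sq c q hq
  rw [← hd] at hC₁
  rw [natCard_selmerGroup_baseChange_quadratic_of_odd W K h2 hθ hc p hp2,
    natCard_selmerGroup_eq_of_variableChange (p : ℤ) hC₁]

end Selmer

end WeierstrassCurve

end
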